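/-
Copyright (c) 2026 the pub-hodgecm-mathlib formalisation cell (harness21).  Prover seat hodgecm-mathlib-LH7-p10 (g3), req620 Track A «(D-RAM) FOUR-FRAME» squad
((β₂) road (R-36) «PURE-CELL LEDGER», lane C = type RamM, β₂ sub-dealer LH4-p04 (g10) 🃏«GO» 03:09:15Z «LH7-p10: START F4-RamM»: the F4 twin — the index-two class letters
of the type-RamM one-field frame read off the ‹OFF_C.letter.v2› block letters, and THE ONE NEW LEMMA: the lane-C reference pair), helper lane on h413 =
stmt-HodgeConjecture-24833 (count-neutral).  2026-09-05.
-/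
import Summits.HodgeConjecture.HodgeConjecture.Theorems.F0P3cDyRamRamKFrameClassLetters   -- ★ p864373 (LH4-p19 (g3), F4): `deep_of_datum` (lane-free), `dich_of_datum` (any ramified `Θ`-datum); brings ★ Lit `IsRamifiedQuadraticDatum`
import HarnessLib

/-!
# Crux `H413`, line LH4 «(D-RAM) FOUR-FRAME» — the (β₂) road (R-36), (OFF_C) residue, lane C (type RamM): «THE CLASS LETTERS OF THE RamM FRAME, FROM THE BLOCK» —
# `hFgap` from the fixed-fixed law `_c19`, and the REFERENCE PAIR `(κ₀, ξ₀) ⊂ Fix Θ` of the line `Tr_ρ = 1` at every admissible size, built from the uniformiser `π♮ = ϖM·ΘϖM`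
# of `Fix Θ`: `κ₀ = π♮ ∕ (π♮ − ρπ♮)` (`|κ₀| = exp(2d′ − 2)`, the MINIMAL size of a trace-one element), `ξ₀ = ((π♮ − ρπ♮)·(π♮ρπ♮)ⁿ)⁻¹` (`|ξ₀| = exp(2d′ + 4n)`)

Cell `hodgecm-mathlib` (D-0151), FLOOR 0, crux item H413 = `stmt-HodgeConjecture-24833`, route of record `HCCMUnconditional`; squads F0∕P3c∕LH4 ∕ LH7; lane
`--supports stmt-HodgeConjecture-24833 --as helper` (count-neutral; pays NO tier-0 row).  THEOREMS ONLY (no `def`, no instance, no notation, no `sorry`, default heartbeats);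
★-only imports; states NO law; ‹HU_RAY_C♮› ‹HL_RAY_C♭› ‹HC_RAY_C♮›, (OFF_C), (β₂) stay HYPOTHESES.  DATUM-FREE field algebra on ONE valued field `M` with two commuting
isometric involutions `ρ, Θ` (§1–§2); §3 adds the lane-C size tokens `|jE ϖ| = exp(−2)`, `|α − ρα| = exp(−d_ρ)`, `2d′ = d_ρ + 2s0`.

WHY (LANEC-RAY-PORT-PLAN.v1 §1 row F4, β₂ sub-dealer «GO» 03:09:15Z).  Lane B's RAY worker ★ `…Beta2ConesOffRowUpperRayWorker` takes four CLASS LETTERS and a REFERENCE PAIR from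
★ F4 `…RamKFrameClassLetters`, whose `exists_refPair_of_frame` ∕ `exists_flipWitness_of_frame` go through the UNRAMIFIED third field (`|κ₀| ≤ 1` from an unramified generator
`α′`).  In lane C (`M ∕ E` totally ramified, `_c1 : |jE a| = |a|²`) the third field `K♮ = Fix Θ` is RAMIFIED over the doubly fixed field `F` (value group `exp(4ℤ)`, `_c19`), with
different exponent `d′` (`_c28 : |π♮ − ρπ♮| = exp(−2d′)`, `π♮ = ϖM·ΘϖM`; `_c29 + _c22 : 2d′ = d_ρ + 2s0`): the `ρ`-anti elements of `K♮` have valuations `exp(2d′ + 4ℤ)` ONLY, and a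
trace-one element of `K♮` has `|κ| ≥ exp(2d′ − 2)` (Serre III §3: `Tr(𝔭^k_{K♮}) = 𝔭_F^{⌊(k + d′)∕2⌋}`).  Hence the dictionary of this file:
* `hFgap` (`∀ z ∈ F, |jEϖ| < |z| ≤ 1 → |z| = 1`) ⟸ `_c19` and `|jE ϖ| = exp(−2)` (§1 `fgap_of_fixedFixed`, stated with any `P`, `|P| = exp(−2)`);
* `hdeep` = ★ F4 `deep_of_datum` VERBATIM (E-datum + `hjv hjfix hΘj`, lane-free); `hdich` = ★ F4 `dich_of_datum _c8`; `hwit` = `_c20` VERBATIM; `hFN` = `_c14`;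
* THE REFERENCE PAIR (§2 `exists_refPair_ramM`): for every `n : ℕ`, `κ₀, ξ₀ ∈ Fix Θ` with `κ₀ + ρκ₀ = 1`, `ρξ₀ = −ξ₀ ≠ 0`, `|κ₀| = exp(2d′ − 2)`, `|ξ₀| = exp(2d′ + 4n)` — from `π♮`,
  `ξ₁ = π♮ − ρπ♮` (anti, `Θ`-fixed, `|ξ₁| = exp(−2d′)`), `P₀ = π♮·ρπ♮` (doubly fixed, `|P₀| = exp(−4)`): `κ₀ = π♮∕ξ₁`, `ξ₀ = (ξ₁·P₀ⁿ)⁻¹`; no third-field package needed.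
* THE CELL CURRENCY (§3): on a populated upper-line cell `(j, b)` of lane C the glued vertex has `|κ̂|·|cc(α − ρα)| = |jEϖ|^b`, `|cc(α − ρα)| = exp(−2j − d_ρ)`, so `|κ̂| =
  exp(2(j − b) + d_ρ)`; this is an anti size `exp(2d′ + 4n)` iff `j = b + s0 + 2n` — the GENERIC branch `b + s0 ≤ j ∧ (j − b − s0) % 2 = 0` of the lane-C parity letter — where
  `refPair_cell_sizes` gives ★ R1b-A's `hκ₀v : |κ₀| ≤ |ξ₀|` (strict) and ★ W1's `hRe : |ξ₀|·|cc(α − ρα)| = |jEϖ|^b`; on the DIAGONAL branch `j + 1 = b + s0` (`|κ̂| = |κ₀|`, no anti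
  element of that size) the pair at `n = 0` still serves ★ R1b-A (`refPair_diag_sizes`: `|ξ₀|·|cc(α − ρα)| = |jEϖ|^{b−1} ≥ |jEϖ|^b`) but NOT ★ W1's `hRe` — the diagonal cells are a
  separate worker (digit in the ball `|V| ≤ |ϖ|²`, see LANEC-RAY-PROGRAM.v1).
HONEST LABEL.  Count-neutral local algebra; nothing printed is asserted; no census law is stated; the lane-C RAY ∕ MIX bands stay OPEN; `HC_CM` is proved only modulo the 7 printed
citations (2 remaining named inputs: hLiu418 = `stmt-HodgeConjecture-24832`, h413 = `stmt-HodgeConjecture-24833`) until rung 0 closes.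
## References
* [Serre1979] J.-P. Serre, *Local Fields*, GTM 67 (1979): Ch. III §3 Prop. 7 (trace of an ideal), Ch. III §6 Prop. 12, Ch. V §3 Prop. 5, Cor. 2–3.
* [Kottwitz1986BaseChangeUnits] R. E. Kottwitz, *Base change for unit elements of Hecke algebras*, Compositio Math. 60 (1986): §1 pp. 240–241, §3.
* [Jacobowitz1962] R. Jacobowitz, *Hermitian forms over local fields*, Amer. J. Math. 84 (1962): §4.
-/

set_option autoImplicit false

noncomputable section

namespace Summit.HodgeConjecture.HodgeConjecture.Cruxes.H413.F0P3cDyRamRamMFrameClassLettersOfBlock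

open scoped Valued WithZero
open WithZero

variable {E M : Type} [Field E] [Valued E ℤᵐ⁰] [Field M] [Valued M ℤᵐ⁰] {ρ Θ : M →+* M} {α : M}

/-! ## §1 `hFgap` from the fixed-fixed law -/

omit [Field E] [Valued E ℤᵐ⁰] in
/-- **`hFgap` FROM THE FIXED-FIXED LAW `_c19`**: if every non-zero doubly fixed element has valuation `exp(4n)` and `|P| = exp(−2)` (`P := jE ϖ` in lane C), then no doubly fixed
`z` has `|P| < |z| ≤ 1` except `|z| = 1` — ★ R1b-A ∕ ★ p863914's letter `hFgap` with `jE ϖ` for `P`. [cite: Serre1979, Ch. V §3] -/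
theorem fgap_of_fixedFixed (hF4 : ∀ z : M, ρ z = z → Θ z = z → z ≠ 0 → ∃ n : ℤ, Valued.v z = exp (4 * n))
    {P : M} (hP : Valued.v P = exp (-2 : ℤ)) :
    ∀ z : M, ρ z = z → Θ z = z → Valued.v P < Valued.v z → Valued.v z ≤ 1 → Valued.v z = 1 := by
  intro z hρz hΘz hlt hle
  have hz0 : z ≠ 0 := fun h0 => by rw [h0, map_zero] at hlt; exact not_lt_of_ge zero_le hlt
  obtain ⟨n, hn⟩ := hF4 z hρz hΘz hz0
  rw [hn] at hlt hle ⊢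
  rw [hP, exp_lt_exp] at hlt
  rw [← exp_zero, exp_le_exp] at hle
  rw [← exp_zero]; congr 1; omega

/-! ## §2 The lane-C reference pair -/

omit [Field E] [Valued E ℤᵐ⁰] in
/-- **THE REFERENCE PAIR OF THE TYPE-RamM FRAME.**  `ρ, Θ` commuting isometric involutions of `M`; `|ϖM| = exp(−1)`; the Klein letter `|ϖM·ΘϖM − ρ(ϖM·ΘϖM)| = exp(−2d′)` (`_c28`).
THEN for every `n : ℕ` there are `κ₀, ξ₀ ∈ Fix Θ` with `κ₀ + ρκ₀ = 1`, `ρξ₀ = −ξ₀`, `ξ₀ ≠ 0`, `|κ₀| = exp(2d′ − 2)` and `|ξ₀| = exp(2d′ + 4n)`: with `π♮ = ϖM·ΘϖM`, `ξ₁ = π♮ − ρπ♮`,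
`P₀ = π♮·ρπ♮`, take `κ₀ = π♮∕ξ₁`, `ξ₀ = (ξ₁·P₀ⁿ)⁻¹`. [cite: Serre1979, Ch. III §3 Prop. 7; Ch. III §6 Prop. 12] -/
theorem exists_refPair_ramM (hρρ : ∀ x, ρ (ρ x) = x) (hvρ : ∀ x, Valued.v (ρ x) = Valued.v x)
    (hΘΘ : ∀ x, Θ (Θ x) = x) (hΘρ : ∀ x, Θ (ρ x) = ρ (Θ x)) (hvΘ : ∀ x, Valued.v (Θ x) = Valued.v x)
    {ϖM : M} (hϖM : Valued.v ϖM = exp (-1 : ℤ)) {d' : ℕ} (hd' : Valued.v (ϖM * Θ ϖM - ρ (ϖM * Θ ϖM)) = exp (-(2 * (d' : ℤ)))) (n : ℕ) :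
    ∃ κ₀ ξ₀ : M, κ₀ + ρ κ₀ = 1 ∧ Θ κ₀ = κ₀ ∧ ρ ξ₀ = -ξ₀ ∧ Θ ξ₀ = ξ₀ ∧ ξ₀ ≠ 0 ∧
      Valued.v κ₀ = exp (2 * (d' : ℤ) - 2) ∧ Valued.v ξ₀ = exp (2 * (d' : ℤ) + 4 * (n : ℤ)) := by
  -- the uniformiser `π♮ = ϖM·ΘϖM` of `Fix Θ`
  set P : M := ϖM * Θ ϖM with hPdef
  have hΘP : Θ P = P := by rw [hPdef, map_mul, hΘΘ, mul_comm]
  have hPv : Valued.v P = exp (-2 : ℤ) := by rw [hPdef, Valuation.map_mul, hvΘ, hϖM, ← exp_add]; norm_num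
  -- its `ρ`-skew `ξ₁`, anti and `Θ`-fixed, `|ξ₁| = exp(−2d′)`
  set ξ₁ : M := P - ρ P with hξ₁def
  have hξ₁v : Valued.v ξ₁ = exp (-(2 * (d' : ℤ))) := hd'
  have hξ₁0 : ξ₁ ≠ 0 := fun h0 => by rw [h0, map_zero] at hξ₁v; exact (exp_ne_zero hξ₁v.symm).elim
  have hρξ₁ : ρ ξ₁ = -ξ₁ := by rw [hξ₁def, map_sub, hρρ]; ring
  have hΘξ₁ : Θ ξ₁ = ξ₁ := by rw [hξ₁def, map_sub, hΘρ, hΘP]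
  -- the doubly fixed `P₀ = π♮·ρπ♮`, `|P₀| = exp(−4)`
  set P₀ : M := P * ρ P with hP₀def
  have hP₀v : Valued.v P₀ = exp (-4 : ℤ) := by rw [hP₀def, Valuation.map_mul, hvρ, hPv, ← exp_add]; norm_num
  have hP₀0 : P₀ ≠ 0 := fun h0 => by rw [h0, map_zero] at hP₀v; exact (exp_ne_zero hP₀v.symm).elim
  have hρP₀ : ρ P₀ = P₀ := by rw [hP₀def, map_mul, hρρ, mul_comm]
  have hΘP₀ : Θ P₀ = P₀ := by rw [hP₀def, map_mul, hΘρ, hΘP]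
  refine ⟨P / ξ₁, (ξ₁ * P₀ ^ n)⁻¹, ?_, ?_, ?_, ?_, inv_ne_zero (mul_ne_zero hξ₁0 (pow_ne_zero _ hP₀0)), ?_, ?_⟩
  · rw [map_div₀, hρξ₁, div_neg, ← sub_eq_add_neg, ← sub_div, ← hξ₁def, div_self hξ₁0]
  · rw [map_div₀, hΘP, hΘξ₁]
  · rw [map_inv₀, map_mul, hρξ₁, map_pow, hρP₀, neg_mul, inv_neg]
  · rw [map_inv₀, map_mul, hΘξ₁, map_pow, hΘP₀]
  · rw [map_div₀, hPv, hξ₁v, ← exp_sub]; congr 1; ring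
  · rw [map_inv₀, Valuation.map_mul, Valuation.map_pow, hξ₁v, hP₀v, ← exp_nsmul, ← exp_add, ← exp_neg]
    congr 1; rw [nsmul_eq_mul]; ring

/-! ## §3 The cell currency of the pair -/

omit [Valued E ℤᵐ⁰] in
/-- **THE PAIR ON A GENERIC UPPER-LINE CELL OF LANE C** (`j = b + s0 + 2n`): with `|jE ϖ| = exp(−2)`, `|α − ρα| = exp(−d_ρ)`, `2d′ = d_ρ + 2s0`, a pair of sizes
`|κ₀| = exp(2d′ − 2)`, `|ξ₀| = exp(2d′ + 4n)` has `|κ₀| < |ξ₀|` (★ R1b-A's `hκ₀v`) and `|ξ₀|·|jEϖ^j·(α − ρα)| = |jEϖ|^b` (★ W1's `hRe`, ★ R1b-A's `hR` with equality).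
[cite: Kottwitz1986BaseChangeUnits, §3] [cite: Serre1979, Ch. III §6 Prop. 12] -/
theorem refPair_cell_sizes {jE : E →+* M} {ϖ : E} (hjϖ : Valued.v (jE ϖ) = exp (-2 : ℤ))
    {dρ : ℕ} (hαρ : Valued.v (α - ρ α) = exp (-(dρ : ℤ))) {d' s0 : ℕ} (hds : 2 * d' = dρ + 2 * s0)
    {κ₀ ξ₀ : M} {n : ℕ} (hκ₀v : Valued.v κ₀ = exp (2 * (d' : ℤ) - 2)) (hξv : Valued.v ξ₀ = exp (2 * (d' : ℤ) + 4 * (n : ℤ)))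
    {j b : ℕ} (hjbn : j = b + s0 + 2 * n) :
    Valued.v κ₀ < Valued.v ξ₀ ∧ Valued.v ξ₀ * Valued.v (jE ϖ ^ j * (α - ρ α)) = Valued.v (jE ϖ) ^ b := by
  refine ⟨by rw [hκ₀v, hξv, exp_lt_exp]; omega, ?_⟩
  rw [Valuation.map_mul, Valuation.map_pow, hjϖ, hαρ, hξv, ← exp_nsmul, ← exp_nsmul, ← exp_add, ← exp_add, nsmul_eq_mul, nsmul_eq_mul]
  congr 1; omega

omit [Valued E ℤᵐ⁰] in
/-- **THE PAIR ON A DIAGONAL CELL OF LANE C** (`j + 1 = b + s0`, the branch `|κ̂| = |κ₀|`): the pair at `n = 0` (`|ξ₀| = exp(2d′)`) has `|κ₀| < |ξ₀|` and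
`|ξ₀|·|jEϖ^j·(α − ρα)| = |jEϖ|^{b−1}`, hence ★ R1b-A's `hR : |jEϖ|^b ≤ |ξ₀|·|jEϖ^j·(α − ρα)|` (not ★ W1's equality). [cite: Kottwitz1986BaseChangeUnits, §3] [cite: Serre1979, Ch. III §6 Prop. 12] -/
theorem refPair_diag_sizes {jE : E →+* M} {ϖ : E} (hjϖ : Valued.v (jE ϖ) = exp (-2 : ℤ))
    {dρ : ℕ} (hαρ : Valued.v (α - ρ α) = exp (-(dρ : ℤ))) {d' s0 : ℕ} (hds : 2 * d' = dρ + 2 * s0)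
    {κ₀ ξ₀ : M} (hκ₀v : Valued.v κ₀ = exp (2 * (d' : ℤ) - 2)) (hξv : Valued.v ξ₀ = exp (2 * (d' : ℤ) + 4 * ((0 : ℕ) : ℤ)))
    {j b : ℕ} (hb1 : 1 ≤ b) (hjbd : j + 1 = b + s0) :
    Valued.v κ₀ < Valued.v ξ₀ ∧ Valued.v ξ₀ * Valued.v (jE ϖ ^ j * (α - ρ α)) = Valued.v (jE ϖ) ^ (b - 1) ∧
      Valued.v (jE ϖ) ^ b ≤ Valued.v ξ₀ * Valued.v (jE ϖ ^ j * (α - ρ α)) := by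
  have he : Valued.v ξ₀ * Valued.v (jE ϖ ^ j * (α - ρ α)) = Valued.v (jE ϖ) ^ (b - 1) := by
    rw [Valuation.map_mul, Valuation.map_pow, hjϖ, hαρ, hξv, ← exp_nsmul, ← exp_nsmul, ← exp_add, ← exp_add, nsmul_eq_mul, nsmul_eq_mul]
    congr 1; push_cast; omega
  refine ⟨by rw [hκ₀v, hξv, exp_lt_exp]; omega, he, ?_⟩
  rw [he, hjϖ, ← exp_nsmul, ← exp_nsmul, exp_le_exp, nsmul_eq_mul, nsmul_eq_mul]
  omega

end Summit.HodgeConjecture.HodgeConjecture.Cruxes.H413.F0P3cDyRamRamMFrameClassLettersOfBlock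

end
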